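import Literature.Probability.Percolation.FourFunctionsProdBernoulli
import HarnessLib

/-!
# Complementary partition pairs of four points: `P(π)·P(σ) ≤ P(a|b|c|d)·P(abcd)` whenever `π ∧ σ = 0̂` and `π ∨ σ = 1̂`

Support file for crux `stmt-CriticalPhenomena-4575` (`NoHeavyLowerTail`), seat `prim-l12-p1` gen 23 (`--supports`); closes the
"complementary-pair conjecture on `Π₄`" recorded by this seat's gen 22 (memo `run/shared/lean/prim/prim-l12/FROM-prim-l12-p1-g22-DIAMOND-ALL-GRAPHS.md`,
exact census kit j199892: 0 violations on 27 pairs × 2 500 graphs).  Bond percolation `μ = prodBernoulli w` on a finite vertex type, four vertices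
`a, b, c, d`, `P(π)` = probability that the open clusters induce the partition `π` of `{a,b,c,d}`.

THE (elementary) PRINCIPLE.  If two partitions `π, σ` of the marked points are COMPLEMENTARY in the partition lattice (meet = all singletons,
join = one block), then a configuration `ω₁` of the cell `π` and a configuration `ω₂` of the cell `σ` INTERSECT in a configuration of the discrete cell
(connectivity in `ω₁ ∩ ω₂` refines both `π` and `σ`) and UNITE in a configuration of the full cell (connectivity in `ω₁ ∪ ω₂` coarsens both), so the
four-events form of the Ahlswede–Daykin four functions theorem for the log-modular product measure (`prodBernoulli_fourEvents`, Bollobás–Riordan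
Ch. 2 Thm. 7 / eq. (14)) gives `P(π)·P(σ) ≤ P(0̂)·P(1̂)` on every finite weighted graph.  On three points this is the DIAMOND `P(ac|b)P(bc|a) ≤ P(abc)P(a|b|c)`
(`Consts.threePointDiamond_holds`).  On four points the complementary pairs fall into three shapes up to relabelling:
* type A, `[bcd|a]·[ab|c|d]` — in the tree as `CutVertexMinorsAD.minorII` (prim-l12-p2 gen 4, spelled `[abc|d]·[cd|a|b]`);
* type C, `[ab|cd]·[ac|bd]` — in the tree as `Literature…crossingSplits`;
* type B, `[ab|cd]·[bc|a|d]` — THIS FILE (`complementaryPairB`), the remaining shape, same two-line mechanism.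
So all 27 complementary pairs of `Π₄` are theorems (gen 22's observation that type C is not edge-concave only says that the one-edge interpolation
method fails there, not the inequality).  No definitions, no sorries, standard axioms.
-/

noncomputable section

namespace Summit.CriticalPhenomena.PercolationContinuityZ3.Theorems.FourPointComplementaryPairs

open MeasureTheory Set
open Literature.Probability.Percolation Literature.Probability.LatticeModels
open scoped Classical

variable {V : Type*} [Fintype V]

/-- **Complementary pair of type B on four points**: `P(ab|cd) · P(bc|a|d) ≤ P(a|b|c|d) · P(abcd)` on every finite weighted graph, for any
vertices `a b c d` (cells as connection events: `ab|cd = {a↔b, c↔d, a↮c}`, `bc|a|d = {b↔c, a↮b, b↮d, a↮d}`).  Ahlswede–Daykin four events: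
the two cells meet in the discrete partition and join in the full one. [cite: BollobasRiordan2006, Ch. 2 Thm. 7 and eq. (14)] [cite: AhlswedeDaykin1978] -/
theorem complementaryPairB (w : Sym2 V → unitInterval) (a b c d : V) :
    (prodBernoulli w).real (openConn a b ∩ openConn c d ∩ (openConn a c)ᶜ) *
        (prodBernoulli w).real (openConn b c ∩ (openConn a b)ᶜ ∩ (openConn b d)ᶜ ∩ (openConn a d)ᶜ) ≤
      (prodBernoulli w).real ((openConn a b)ᶜ ∩ (openConn a c)ᶜ ∩ (openConn a d)ᶜ ∩
          (openConn b c)ᶜ ∩ (openConn b d)ᶜ ∩ (openConn c d)ᶜ) *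
        (prodBernoulli w).real (openConn a b ∩ openConn a c ∩ openConn a d) := by
  refine prodBernoulli_fourEvents w _ _ _ _ fun ω₁ h₁ ω₂ h₂ => ?_
  have openGraph_le : ∀ {ω ω' : BondConfig V}, ω ⊆ ω' → openGraph ω ≤ openGraph ω' :=
    fun h => BHK2006.openGraph_le h
  have mem : ∀ (ω : BondConfig V) (u v : V),
      ω ∈ (openConn u v : Set (BondConfig V)) ↔ (openGraph ω).Reachable u v := fun _ _ _ => Iff.rfl
  simp only [mem_inter_iff, mem_compl_iff, mem] at h₁ h₂ ⊢
  obtain ⟨⟨hab, hcd⟩, nac⟩ := h₁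
  obtain ⟨⟨⟨hbc, nab⟩, nbd⟩, nad⟩ := h₂
  have hl₁ : openGraph (ω₁ ∩ ω₂) ≤ openGraph ω₁ := openGraph_le inter_subset_left
  have hl₂ : openGraph (ω₁ ∩ ω₂) ≤ openGraph ω₂ := openGraph_le inter_subset_right
  have hu₁ : openGraph ω₁ ≤ openGraph (ω₁ ∪ ω₂) := openGraph_le subset_union_left
  have hu₂ : openGraph ω₂ ≤ openGraph (ω₁ ∪ ω₂) := openGraph_le subset_union_right
  refine ⟨⟨⟨⟨⟨⟨fun h => nab (h.mono hl₂), fun h => nac (h.mono hl₁)⟩, fun h => nad (h.mono hl₂)⟩,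
    fun h => nac (hab.trans (h.mono hl₁))⟩, fun h => nbd (h.mono hl₂)⟩,
    fun h => nbd (hbc.trans (h.mono hl₂))⟩, ?_⟩
  -- join: a↔b (ω₁), b↔c (ω₂), c↔d (ω₁)
  have hab' := hab.mono hu₁
  have hbc' := hbc.mono hu₂
  have hcd' := hcd.mono hu₁
  exact ⟨⟨hab', hab'.trans hbc'⟩, (hab'.trans hbc').trans hcd'⟩

/-- **Type A restated in the same cell conventions** (`[bcd|a]·[ab|c|d] ≤ [a|b|c|d]·[abcd]`); the tree's `CutVertexMinorsAD.minorII` is the same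
inequality up to relabelling — proved here directly for convenience of citation. [cite: BollobasRiordan2006, Ch. 2 Thm. 7 and eq. (14)] -/
theorem complementaryPairA (w : Sym2 V → unitInterval) (a b c d : V) :
    (prodBernoulli w).real (openConn b c ∩ openConn b d ∩ (openConn a b)ᶜ) *
        (prodBernoulli w).real (openConn a b ∩ (openConn a c)ᶜ ∩ (openConn a d)ᶜ ∩ (openConn c d)ᶜ) ≤
      (prodBernoulli w).real ((openConn a b)ᶜ ∩ (openConn a c)ᶜ ∩ (openConn a d)ᶜ ∩
          (openConn b c)ᶜ ∩ (openConn b d)ᶜ ∩ (openConn c d)ᶜ) *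
        (prodBernoulli w).real (openConn a b ∩ openConn a c ∩ openConn a d) := by
  refine prodBernoulli_fourEvents w _ _ _ _ fun ω₁ h₁ ω₂ h₂ => ?_
  have openGraph_le : ∀ {ω ω' : BondConfig V}, ω ⊆ ω' → openGraph ω ≤ openGraph ω' :=
    fun h => BHK2006.openGraph_le h
  have mem : ∀ (ω : BondConfig V) (u v : V),
      ω ∈ (openConn u v : Set (BondConfig V)) ↔ (openGraph ω).Reachable u v := fun _ _ _ => Iff.rfl
  simp only [mem_inter_iff, mem_compl_iff, mem] at h₁ h₂ ⊢
  obtain ⟨⟨hbc, hbd⟩, nab⟩ := h₁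
  obtain ⟨⟨⟨hab, nac⟩, nad⟩, ncd⟩ := h₂
  have hl₁ : openGraph (ω₁ ∩ ω₂) ≤ openGraph ω₁ := openGraph_le inter_subset_left
  have hl₂ : openGraph (ω₁ ∩ ω₂) ≤ openGraph ω₂ := openGraph_le inter_subset_right
  have hu₁ : openGraph ω₁ ≤ openGraph (ω₁ ∪ ω₂) := openGraph_le subset_union_left
  have hu₂ : openGraph ω₂ ≤ openGraph (ω₁ ∪ ω₂) := openGraph_le subset_union_right
  refine ⟨⟨⟨⟨⟨⟨fun h => nab (h.mono hl₁), fun h => nac (h.mono hl₂)⟩, fun h => nad (h.mono hl₂)⟩,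
    fun h => nac (hab.trans (h.mono hl₂))⟩, fun h => nad (hab.trans (h.mono hl₂))⟩,
    fun h => ncd (h.mono hl₂)⟩, ?_⟩
  have hab' := hab.mono hu₂
  have hbc' := hbc.mono hu₁
  have hbd' := hbd.mono hu₁
  exact ⟨⟨hab', hab'.trans hbc'⟩, hab'.trans hbd'⟩

end Summit.CriticalPhenomena.PercolationContinuityZ3.Theorems.FourPointComplementaryPairs
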